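import Summits.HubbardSuperconductivity.HubbardSuperconductivity.Theorems.BalabanIRBirComplexStableXYRSectorCostLower
import Literature.MathematicalPhysics.QuantumFieldTheory.TorusChartCombGauge
import Literature.MathematicalPhysics.QuantumFieldTheory.TorusChartCurlBound
import Literature.MathematicalPhysics.QuantumFieldTheory.VillainAngleForm
import Literature.Analysis.SpecialFunctions.TiltedThetaPoisson
import HarnessLib

/-!
# Crux `BirComplexStableXYR` (stmt-HubbardSuperconductivity-14845), line `fat-gaussian-defect-calculus`, chapter 2
# §2.1: the Gaussian sector partition function is finite, with an explicit extensive bound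

Support file (prover seat 1, route BalabanIR; item G2 "Coulomb strain σ_a", sector sums).

In lead c7's representation (`FSUnfolding.stub_fsRepresentation`) the sectors are indexed by the tree-gauge
(comb-vanishing) integer `1`-cochains `a` and weighted by `exp(−(K/2)𝒬(σ a))`.  This file bounds the GAUSSIAN SECTOR
PARTITION FUNCTION `S_G := Σ'_a exp(−(K/2)𝒬(σ a))` for a table with `Σ c_n = 0` and coercivity (C) at range `r ≥ 2`:

* `gss_label_injective` — a comb-vanishing cochain is determined by its curl `d₁ a` and its column totals
  `(Σ_x a(x,i))_i` (sector labelling `TorusChart.eq_of_comb_of_d₁_eq_of_wind_eq` + `scl_sum_intCast_of_d₁_eq_zero`);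
* `gss_weight_le` — `exp(−(K/2)𝒬(σ a)) ≤ Π_{plaquette entries} e^{−(Kc₀π²/12)(d₁a)²} · Π_i e^{−(4π²Kc₀/|Λ|)(Σ_x a(x,i))²}`
  (`stub_sectorCostLower` and the curl bound `TorusChart.sum_d₁_sq_le`);
* **`stub_gaussianSectorSumBound`** (registered stub): the sector weights are summable over the comb-vanishing cochains
  and `S_G ≤ G(Kc₀π²/12)^{9|Λ|} · G(4π²Kc₀/|Λ|)³`, `G(s) = Σ_{n∈ℤ} e^{−s n²}` (`gaussLatticeSum`; `G(s) ≤ 1 + 2/(eˢ−1)`,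
  `ThetaRiemannSum.gaussLatticeSum_le`) — an extensive vortex factor `exp(O(|Λ| e^{−Kc₀π²/12}))` times a polynomial
  flux factor (products of independent Gaussian sums over `ℤ^ι`, `VillainAngle.tsum_pi_prod_real`).

No Pythagoras hypothesis is needed.  No definitions; sorry-free. [folklore: Fröhlich–Spencer, CMP 81 (1981) §3–4
(energy estimates for the vortex/flux sums)]
-/

noncomputable section

namespace Summit.HubbardSuperconductivity.HubbardSuperconductivity.Theorems

set_option linter.dupNamespace false -- summit = problem name (single-conjunct summit), D-0017

open scoped BigOperators ComplexConjugate
open Complex Summit.HubbardSuperconductivity.BirComplexStableXYNegative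
open Literature.Probability.LatticeModels Literature.MathematicalPhysics.QuantumFieldTheory
open Literature.Analysis.SpecialFunctions

section GaussianSectorSum

variable {r : ℕ} {L M : ℕ} [NeZero L] [NeZero M]

/-- **The curl and the column totals determine a comb-vanishing cochain.**  If two integer `1`-cochains vanish on the
comb, have the same curl and the same column totals `Σ_x a(x,i)`, they are equal (their difference is flat, hence a
seam cochain `seam w` by the sector labelling, and its column totals `|Λ| w_i/N_i` vanish). [folklore] -/
theorem gss_eq_of_d₁_eq_of_colsum_eq {Λ' : Type*} [AddCommGroup Λ'] [Fintype Λ'] {d : ℕ} (F : TorusChart Λ' d)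
    {a b : Λ' → Fin d → ℤ} (ha : ∀ x μ, F.IsCombEdge x μ → a x μ = 0) (hb : ∀ x μ, F.IsCombEdge x μ → b x μ = 0)
    (hd : F.d₁ a = F.d₁ b) (hcol : ∀ i, ∑ x, a x i = ∑ x, b x i) : a = b := by
  refine F.eq_of_comb_of_d₁_eq_of_wind_eq ha hb hd ?_
  have hflat : F.d₁ (a - b) = 0 := by rw [F.d₁_sub, hd, sub_self]
  have hw : F.wind (a - b) = 0 := by
    funext i
    have h := scl_sum_intCast_of_d₁_eq_zero F (a - b) hflat i
    have hzero : ((∑ x, (a - b) x i : ℤ) : ℝ) = 0 := by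
      have : ∑ x, (a - b) x i = 0 := by
        simp only [Pi.sub_apply, Finset.sum_sub_distrib, hcol i, sub_self]
      rw [this, Int.cast_zero]
    rw [hzero] at h
    have hcard : (0 : ℝ) < Fintype.card Λ' := TorusChart.card_pos_real (Λ := Λ')
    have hper : (0 : ℝ) < F.period i := by exact_mod_cast F.period_pos i
    have h' : (Fintype.card Λ' : ℝ) * ((F.wind (a - b) i : ℤ) : ℝ) = 0 := by
      field_simp at h
      linarith
    have h'' : ((F.wind (a - b) i : ℤ) : ℝ) = 0 := by
      rcases mul_eq_zero.1 h' with h1 | h1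
      · exact absurd h1 hcard.ne'
      · exact h1
    exact_mod_cast h''
  have := F.wind_sub a b
  rw [hw] at this
  exact (sub_eq_zero.1 this.symm)

/-- The **sector label** used for the bound: the plaquette entries of the curl and the three column totals, as one
integer vector. [folklore] -/
theorem gss_label_injective :
    Function.Injective (fun a : {a : Λ L M → Fin 3 → ℤ // ∀ (y : Λ L M) (μ : Fin 3),
        (∀ ν : Fin 3, μ < ν → (TorusChart.piProdZMod 2 L M).cval ν y = 0) →
        (TorusChart.piProdZMod 2 L M).cval μ y + 1 < (TorusChart.piProdZMod 2 L M).period μ → a y μ = 0} =>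
      (Sum.elim (fun p : Λ L M × Fin 3 × Fin 3 => (TorusChart.piProdZMod 2 L M).d₁ a.1 p.1 p.2.1 p.2.2)
        (fun i : Fin 3 => ∑ x : Λ L M, a.1 x i) : (Λ L M × Fin 3 × Fin 3) ⊕ Fin 3 → ℤ)) := by
  intro a b hab
  apply Subtype.ext
  refine gss_eq_of_d₁_eq_of_colsum_eq (TorusChart.piProdZMod 2 L M) (fun x μ h => a.2 x μ h.1 h.2)
    (fun x μ h => b.2 x μ h.1 h.2) ?_ ?_
  · funext x i j
    have h := congrFun hab (Sum.inl (x, i, j))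
    simpa using h
  · intro i
    have h := congrFun hab (Sum.inr i)
    simpa using h

/-- **The curl of `2πa` is `2π` times the integer curl.** [folklore] -/
theorem gss_d₁_two_pi_mul {Λ' : Type*} [AddCommGroup Λ'] {d : ℕ} (F : TorusChart Λ' d) (a : Λ' → Fin d → ℤ)
    (x : Λ') (i j : Fin d) :
    F.d₁ (fun y μ => 2 * Real.pi * (a y μ : ℝ)) x i j = 2 * Real.pi * ((F.d₁ a x i j : ℤ) : ℝ) := by
  simp only [TorusChart.d₁_apply]
  push_cast
  ring

/-- **Weight bound**: `exp(−(K/2)𝒬(σ a)) ≤ Π_{(x,i,j)} e^{−(Kc₀π²/12)(d₁a(x,i,j))²} · Π_i e^{−(4π²Kc₀/|Λ|)(Σ_x a(x,i))²}`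
for every integer cochain `a`, every strain `σ = 2πa − d₀ψ` of its class and every `K ≥ 0`. [folklore] -/
theorem gss_weight_le (c : Table r) {c₀ : ℝ} (hr : 2 ≤ r) (hc₀ : 0 < c₀)
    (hA : c.sum (fun _ a => a) = 0)
    (hC : ∀ φ : W r → ℝ, c₀ * ∑ w, ∑ w', (1 - Real.cos (φ w - φ w')) ≤ (genF c φ).re)
    (P : (Λ L M → Fin 3 → ℝ) → Λ L M → W r → ℝ)
    (hP : ∀ (ω : Λ L M → Fin 3 → ℝ) (s : Λ L M) (w : W r), P ω s w =
      (TorusChart.piProdZMod 2 L M).lineSum ω 0 (w.1 : ℕ) s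
        + (TorusChart.piProdZMod 2 L M).lineSum ω 1 (w.2.1 : ℕ) (s + (w.1 : ℕ) • (TorusChart.piProdZMod 2 L M).gen 0)
        + (TorusChart.piProdZMod 2 L M).lineSum ω 2 (w.2.2 : ℕ)
          (s + (w.1 : ℕ) • (TorusChart.piProdZMod 2 L M).gen 0 + (w.2.1 : ℕ) • (TorusChart.piProdZMod 2 L M).gen 1))
    (Q : (W r → ℝ) → ℝ) (hQ : ∀ u : W r → ℝ, Q u = (-c.sum (fun n a => a * (((∑ w, (n w : ℝ) * u w) ^ 2 : ℝ) : ℂ))).re)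
    {K : ℝ} (hK : 0 ≤ K) (a : Λ L M → Fin 3 → ℤ) (σ : Λ L M → Fin 3 → ℝ)
    (hσ : ∃ ψ : Λ L M → ℝ, σ = fun x i => 2 * Real.pi * (a x i : ℝ) - (TorusChart.piProdZMod 2 L M).d₀ ψ x i) :
    Real.exp (-(K / 2 * ∑ s : Λ L M, Q (P σ s)))
      ≤ (∏ p : Λ L M × Fin 3 × Fin 3,
            Real.exp (-(K * c₀ * Real.pi ^ 2 / 12 * (((TorusChart.piProdZMod 2 L M).d₁ a p.1 p.2.1 p.2.2 : ℤ) : ℝ) ^ 2)))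
        * ∏ i : Fin 3, Real.exp (-(4 * Real.pi ^ 2 * K * c₀ / (Fintype.card (Λ L M) : ℝ)
            * ((∑ x : Λ L M, a x i : ℤ) : ℝ) ^ 2)) := by
  set F := TorusChart.piProdZMod 2 L M with hF
  -- the joint lower bound on the cost
  have hlow := stub_sectorCostLower r c c₀ hr hc₀ hA hC L M P hP Q hQ a σ hσ
  -- the Coulomb energy dominates the local vortex energy: `‖coexact (d₁ω)‖² ≥ ‖d₁ω‖²/48`
  set ω : Λ L M → Fin 3 → ℝ := fun x i => 2 * Real.pi * (a x i : ℝ) with hω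
  have hcurl : ∑ x : Λ L M, ∑ i : Fin 3, ∑ j : Fin 3, (F.d₁ ω x i j) ^ 2
      ≤ 16 * (3 : ℕ) * ∑ x : Λ L M, ∑ i : Fin 3, (F.coexact (F.d₁ ω) x i) ^ 2 := by
    have h := F.sum_d₁_sq_le (F.coexact (F.d₁ ω))
    rw [F.d₁_coexact_d₁] at h
    exact h
  have hd₁ : ∑ x : Λ L M, ∑ i : Fin 3, ∑ j : Fin 3, (F.d₁ ω x i j) ^ 2
      = 4 * Real.pi ^ 2 * ∑ p : Λ L M × Fin 3 × Fin 3, ((F.d₁ a p.1 p.2.1 p.2.2 : ℤ) : ℝ) ^ 2 := by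
    have hterm : ∀ (x : Λ L M) (i j : Fin 3), (F.d₁ ω x i j) ^ 2 = 4 * Real.pi ^ 2 * ((F.d₁ a x i j : ℤ) : ℝ) ^ 2 := by
      intro x i j
      rw [hω, gss_d₁_two_pi_mul]
      ring
    simp only [hterm, ← Finset.mul_sum]
    congr 1
    simp only [Fintype.sum_prod_type]
  -- assemble the exponent inequality
  rw [← Real.exp_sum, ← Real.exp_sum, ← Real.exp_add]
  apply Real.exp_le_exp.2
  have hsum1 : ∑ p : Λ L M × Fin 3 × Fin 3, -(K * c₀ * Real.pi ^ 2 / 12 * ((F.d₁ a p.1 p.2.1 p.2.2 : ℤ) : ℝ) ^ 2)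
      = -(K * c₀ * Real.pi ^ 2 / 12) * ∑ p : Λ L M × Fin 3 × Fin 3, ((F.d₁ a p.1 p.2.1 p.2.2 : ℤ) : ℝ) ^ 2 := by
    rw [Finset.mul_sum]; exact Finset.sum_congr rfl fun p _ => by ring
  have hsum2 : ∑ i : Fin 3, -(4 * Real.pi ^ 2 * K * c₀ / (Fintype.card (Λ L M) : ℝ) * ((∑ x : Λ L M, a x i : ℤ) : ℝ) ^ 2)
      = -(4 * Real.pi ^ 2 * K * c₀) * ∑ i : Fin 3, ((∑ x : Λ L M, a x i : ℤ) : ℝ) ^ 2 / (Fintype.card (Λ L M) : ℝ) := by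
    rw [Finset.mul_sum]; exact Finset.sum_congr rfl fun i _ => by ring
  rw [hsum1, hsum2]
  have hcoex : 0 ≤ ∑ x : Λ L M, ∑ i : Fin 3, (F.coexact (F.d₁ ω) x i) ^ 2 :=
    Finset.sum_nonneg fun x _ => Finset.sum_nonneg fun i _ => sq_nonneg _
  have hsq : 0 ≤ ∑ p : Λ L M × Fin 3 × Fin 3, ((F.d₁ a p.1 p.2.1 p.2.2 : ℤ) : ℝ) ^ 2 :=
    Finset.sum_nonneg fun p _ => sq_nonneg _
  have hfl : 0 ≤ ∑ i : Fin 3, ((∑ x : Λ L M, a x i : ℤ) : ℝ) ^ 2 / (Fintype.card (Λ L M) : ℝ) :=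
    Finset.sum_nonneg fun i _ => div_nonneg (sq_nonneg _) (Nat.cast_nonneg _)
  have hpi : 0 ≤ Real.pi ^ 2 := sq_nonneg _
  -- `K c₀ (π²/12) Σ (d₁a)² ≤ K c₀ ‖coexact‖²` and the flux term is carried verbatim
  have h16 : (16 * (3 : ℕ) : ℝ) = 48 := by norm_num
  rw [h16] at hcurl
  rw [hd₁] at hcurl
  nlinarith [mul_nonneg hK hc₀.le, mul_nonneg (mul_nonneg hK hc₀.le) hsq, mul_nonneg (mul_nonneg hK hc₀.le) hcoex,
    mul_nonneg (mul_nonneg hK hc₀.le) hfl, hlow, hcurl]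

/-- **Registered stub `stub_gaussianSectorSumBound` (prover seat 1 on stmt-HubbardSuperconductivity-14845; chapter 2
§2.1): the Gaussian sector partition function is finite with an explicit extensive bound.**  For a table with
`Σ c_n = 0` and coercivity (C) at range `r ≥ 2`, any map `σ` on the comb-vanishing integer cochains with
`σ a = 2πa − d₀ψ_a` (the Pythagoras property is not needed) and every `K > 0`: the weights `exp(−(K/2)𝒬(σ a))` are
summable and `Σ'_a exp(−(K/2)𝒬(σ a)) ≤ G(Kc₀π²/12)^{9|Λ|} · G(4π²Kc₀/|Λ|)³` with `G = gaussLatticeSum`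
(`G(s) = Σ_{n∈ℤ} e^{−sn²} ≤ 1 + 2/(eˢ − 1)`), for every `K > 0`. [folklore] -/
theorem stub_gaussianSectorSumBound : ∀ (r : ℕ) (c : Table r) (c₀ : ℝ), 2 ≤ r → 0 < c₀ → c.sum (fun _ a => a) = 0 → (∀ φ : W r → ℝ, c₀ * ∑ w, ∑ w', (1 - Real.cos (φ w - φ w')) ≤ (genF c φ).re) → ∀ (L M : ℕ) [NeZero L] [NeZero M] (P : (Λ L M → Fin 3 → ℝ) → Λ L M → W r → ℝ), (∀ (ω : Λ L M → Fin 3 → ℝ) (s : Λ L M) (w : W r), P ω s w = (Literature.MathematicalPhysics.QuantumFieldTheory.TorusChart.piProdZMod 2 L M).lineSum ω 0 (w.1 : ℕ) s + (Literature.MathematicalPhysics.QuantumFieldTheory.TorusChart.piProdZMod 2 L M).lineSum ω 1 (w.2.1 : ℕ) (s + (w.1 : ℕ) • (Literature.MathematicalPhysics.QuantumFieldTheory.TorusChart.piProdZMod 2 L M).gen 0) + (Literature.MathematicalPhysics.QuantumFieldTheory.TorusChart.piProdZMod 2 L M).lineSum ω 2 (w.2.2 : ℕ) (s + (w.1 :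 ℕ) • (Literature.MathematicalPhysics.QuantumFieldTheory.TorusChart.piProdZMod 2 L M).gen 0 + (w.2.1 : ℕ) • (Literature.MathematicalPhysics.QuantumFieldTheory.TorusChart.piProdZMod 2 L M).gen 1)) → ∀ (Q : (W r → ℝ) → ℝ), (∀ u : W r → ℝ, Q u = (-c.sum (fun n a => a * (((∑ w, (n w : ℝ) * u w) ^ 2 : ℝ) : ℂ))).re) → ∀ (σ : {a : Λ L M → Fin 3 → ℤ // ∀ (y : Λ L M) (μ : Fin 3), (∀ ν : Fin 3, μ < ν → (Literature.MathematicalPhysics.QuantumFieldTheory.TorusChart.piProdZMod 2 L M).cval ν y = 0) → (Literature.MathematicalPhysics.QuantumFieldTheory.TorusChart.piProdZMod 2 L M).cval μ y + 1 < (Literature.MathematicalPhysics.QuantumFieldTheory.TorusChart.piProdZMod 2 L M).period μ → a y μ = 0} → (Λ L M → Fin 3 → ℝ)), (∀ a, ∃ ψ : Λ L M → ℝ, σ a = fun x i => 2 * Real.pi * (a.1 x i : ℝ) - (Literature.MathematicalPhysics.QuantumFieldTheory.TorusChart.piProdZMod 2 L M).d₀ ψ x i) → ∀ (K : ℝ),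 0 < K → Summable (fun a : {a : Λ L M → Fin 3 → ℤ // ∀ (y : Λ L M) (μ : Fin 3), (∀ ν : Fin 3, μ < ν → (Literature.MathematicalPhysics.QuantumFieldTheory.TorusChart.piProdZMod 2 L M).cval ν y = 0) → (Literature.MathematicalPhysics.QuantumFieldTheory.TorusChart.piProdZMod 2 L M).cval μ y + 1 < (Literature.MathematicalPhysics.QuantumFieldTheory.TorusChart.piProdZMod 2 L M).period μ → a y μ = 0} => Real.exp (-(K / 2 * ∑ s : Λ L M, Q (P (σ a) s)))) ∧ ∑' a : {a : Λ L M → Fin 3 → ℤ // ∀ (y : Λ L M) (μ : Fin 3), (∀ ν : Fin 3, μ < ν → (Literature.MathematicalPhysics.QuantumFieldTheory.TorusChart.piProdZMod 2 L M).cval ν y = 0) → (Literature.MathematicalPhysics.QuantumFieldTheory.TorusChart.piProdZMod 2 L M).cval μ y + 1 < (Literature.MathematicalPhysics.QuantumFieldTheory.TorusChart.piProdZMod 2 L M).period μ → a y μ = 0}, Real.exp (-(K / 2 * ∑ s : Λ L M, Q (P (σ a) s))) ≤ Literature.Analysis.SpecialFunctions.gaussLatticeSum (K * c₀ * Real.pi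 ^ 2 / 12) ^ (9 * Fintype.card (Λ L M)) * Literature.Analysis.SpecialFunctions.gaussLatticeSum (4 * Real.pi ^ 2 * K * c₀ / (Fintype.card (Λ L M) : ℝ)) ^ 3 := by
  intro r c c₀ hr hc₀ hA hC L M _ _ P hP Q hQ σ hcls K hK
  -- the dominating product family over the label lattice `ℤ^ι`, `ι = (Λ × 3 × 3) ⊕ 3`
  set s₁ : ℝ := K * c₀ * Real.pi ^ 2 / 12 with hs₁
  set s₂ : ℝ := 4 * Real.pi ^ 2 * K * c₀ / (Fintype.card (Λ L M) : ℝ) with hs₂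
  set g : ((Λ L M × Fin 3 × Fin 3) ⊕ Fin 3) → ℤ → ℝ :=
    fun ι n => Sum.elim (fun _ => Real.exp (-(s₁ * (n : ℝ) ^ 2))) (fun _ => Real.exp (-(s₂ * (n : ℝ) ^ 2))) ι with hg
  have hg_nonneg : ∀ ι n, 0 ≤ g ι n := by
    intro ι n; rcases ι with p | i <;> exact (Real.exp_pos _).le
  have hcard : (0 : ℝ) < Fintype.card (Λ L M) := TorusChart.card_pos_real (Λ := Λ L M)
  have hs₁pos : 0 < s₁ := by positivity
  have hs₂pos : 0 < s₂ := by positivity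
  have hgsum : ∀ ι, Summable (g ι) := by
    intro ι
    rcases ι with p | i
    · have h := summable_exp_neg_mul_sq_mul_cos hs₁pos 0
      simp only [zero_mul, Real.cos_zero, mul_one] at h
      exact h.congr fun n => by simp [hg]
    · have h := summable_exp_neg_mul_sq_mul_cos hs₂pos 0
      simp only [zero_mul, Real.cos_zero, mul_one] at h
      exact h.congr fun n => by simp [hg]
  obtain ⟨hGsum, hGeq⟩ := VillainAngle.tsum_pi_prod_real g hg_nonneg hgsum
  -- the label map and the domination
  set Lab := (fun a : {a : Λ L M → Fin 3 → ℤ // ∀ (y : Λ L M) (μ : Fin 3),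
      (∀ ν : Fin 3, μ < ν → (TorusChart.piProdZMod 2 L M).cval ν y = 0) →
      (TorusChart.piProdZMod 2 L M).cval μ y + 1 < (TorusChart.piProdZMod 2 L M).period μ → a y μ = 0} =>
    (Sum.elim (fun p : Λ L M × Fin 3 × Fin 3 => (TorusChart.piProdZMod 2 L M).d₁ a.1 p.1 p.2.1 p.2.2)
      (fun i : Fin 3 => ∑ x : Λ L M, a.1 x i) : (Λ L M × Fin 3 × Fin 3) ⊕ Fin 3 → ℤ)) with hLab
  have hinj : Function.Injective Lab := gss_label_injective
  have hdom : ∀ a, Real.exp (-(K / 2 * ∑ s : Λ L M, Q (P (σ a) s))) ≤ ∏ ι, g ι (Lab a ι) := by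
    intro a
    have h := gss_weight_le c hr hc₀ hA hC P hP Q hQ hK.le a.1 (σ a) (hcls a)
    refine h.trans (le_of_eq ?_)
    rw [Fintype.prod_sum_type]
    simp only [hg, hLab, Sum.elim_inl, Sum.elim_inr, hs₁, hs₂]
  have hnonneg : ∀ a : {a : Λ L M → Fin 3 → ℤ // ∀ (y : Λ L M) (μ : Fin 3),
      (∀ ν : Fin 3, μ < ν → (TorusChart.piProdZMod 2 L M).cval ν y = 0) →
      (TorusChart.piProdZMod 2 L M).cval μ y + 1 < (TorusChart.piProdZMod 2 L M).period μ → a y μ = 0},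
      0 ≤ Real.exp (-(K / 2 * ∑ s : Λ L M, Q (P (σ a) s))) := fun a => (Real.exp_pos _).le
  have hcomp : Summable (fun a => ∏ ι, g ι (Lab a ι)) := hGsum.comp_injective hinj
  have hS : Summable (fun a : {a : Λ L M → Fin 3 → ℤ // ∀ (y : Λ L M) (μ : Fin 3),
      (∀ ν : Fin 3, μ < ν → (TorusChart.piProdZMod 2 L M).cval ν y = 0) →
      (TorusChart.piProdZMod 2 L M).cval μ y + 1 < (TorusChart.piProdZMod 2 L M).period μ → a y μ = 0} =>
      Real.exp (-(K / 2 * ∑ s : Λ L M, Q (P (σ a) s)))) :=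
    hcomp.of_nonneg_of_le hnonneg hdom
  refine ⟨hS, ?_⟩
  calc ∑' a, Real.exp (-(K / 2 * ∑ s : Λ L M, Q (P (σ a) s)))
      ≤ ∑' a, ∏ ι, g ι (Lab a ι) := hS.tsum_le_tsum hdom hcomp
    _ ≤ ∑' m : ((Λ L M × Fin 3 × Fin 3) ⊕ Fin 3) → ℤ, ∏ ι, g ι (m ι) :=
        tsum_comp_le_tsum_of_inj hGsum (fun m => Finset.prod_nonneg fun ι _ => hg_nonneg ι _) hinj
    _ = ∏ ι, ∑' n, g ι n := hGeq
    _ = gaussLatticeSum s₁ ^ (9 * Fintype.card (Λ L M)) * gaussLatticeSum s₂ ^ 3 := by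
        rw [Fintype.prod_sum_type]
        simp only [hg, Sum.elim_inl, Sum.elim_inr, gaussLatticeSum, Finset.prod_const, Finset.card_univ,
          Fintype.card_prod, Fintype.card_fin]
        ring

end GaussianSectorSum

end Summit.HubbardSuperconductivity.HubbardSuperconductivity.Theorems

end
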